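import Summits.ABC.ABC.Theorems.SomeWindowSaving.Negative.Defs
import Summits.ABC.ABC.Theorems.SomeWindowSaving.Negative.FreyCovariants

/-!
# The Frey family of `1 + (4p² − 1) = 4p²` lies in the crux's window slices

Negative-side support (cdisprove of stmt-ABC-1976): for `0 < κ < 4`, `σ > 12` there is `p₀` such
that for every prime `p ≥ p₀` and `X ≥ 2¹³ p³` the reduced global minimal model `freyFamily p`
satisfies every clause of the set-builder of `TwistAmplification.SomeWindowSaving`
(`freyFamily_mem_windowSet`): `p ∣ N ≤ 2¹³ p³`, `(240 p⁴)³ ≤ M⁺ = c₄³ ≤ 2²⁴ p¹²`.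
-/

noncomputable section

open UniqueFactorizationMonoid IsDedekindDomain Real WeierstrassCurve Rat.HeightOneSpectrum
open Literature.NumberTheory.EllipticCurves

namespace Summit.ABC.ABC.Theorems.SomeWindowSaving.Negative

section Family

variable {p : ℕ}

/-- `AB(A+B) = (4p² − 1) · 4p² ≠ 0`. -/
theorem freyFamily_prod_ne_zero (hp : ¬ 3 ∣ p) (hp1 : 1 ≤ p) :
    (1 : ℤ) * (3 * kOf p) * (1 + 3 * kOf p) ≠ 0 := by
  have hk := one_le_kOf hp hp1
  positivity

/-- `16 ∤ AB(A+B) = 4 · (p² (4p² − 1))` for odd `p`. -/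
theorem not_sixteen_dvd_freyFamily_prod (hp : ¬ 3 ∣ p) (hodd : Odd p) :
    ¬ (16 : ℤ) ∣ 1 * (3 * kOf p) * (1 + 3 * kOf p) := by
  have h3 := three_mul_kOf hp
  have hodd' : Odd (p : ℤ) := by exact_mod_cast hodd
  have hprod : (1 : ℤ) * (3 * kOf p) * (1 + 3 * kOf p) =
      4 * ((4 * (p : ℤ) ^ 2 - 1) * (p : ℤ) ^ 2) := by
    rw [h3]; ring
  rw [hprod]
  intro h
  have h4 : (4 : ℤ) ∣ (4 * (p : ℤ) ^ 2 - 1) * (p : ℤ) ^ 2 := by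
    have h' : (4 : ℤ) * 4 ∣ 4 * ((4 * (p : ℤ) ^ 2 - 1) * (p : ℤ) ^ 2) := by norm_num at h ⊢; exact h
    exact (mul_dvd_mul_iff_left (by norm_num : (4 : ℤ) ≠ 0)).mp h'
  have hoddprod : Odd ((4 * (p : ℤ) ^ 2 - 1) * (p : ℤ) ^ 2) := by
    refine Odd.mul ?_ (hodd'.pow)
    have : Even (4 * (p : ℤ) ^ 2) := (show Even (4 : ℤ) by decide).mul_right _
    exact this.sub_odd odd_one
  have h2 : (2 : ℤ) ∣ (4 * (p : ℤ) ^ 2 - 1) * (p : ℤ) ^ 2 := dvd_trans ⟨2, by norm_num⟩ h4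
  exact (Int.not_even_iff_odd.mpr hoddprod) (even_iff_two_dvd.mpr h2)

/-- `|AB(A+B)| = 3K (3K + 1)` with `K = |k|`, and `3K + 1 = 4p²` (naturals, no subtraction). -/
theorem natAbs_freyFamily_prod (hp : ¬ 3 ∣ p) (hp1 : 1 ≤ p) :
    ((1 : ℤ) * (3 * kOf p) * (1 + 3 * kOf p)).natAbs = 3 * (kOf p).natAbs * (4 * p ^ 2) ∧
      3 * (kOf p).natAbs + 1 = 4 * p ^ 2 := by
  have hk := one_le_kOf hp hp1
  have h3 := three_mul_kOf hp
  have hK : |kOf p| = kOf p := abs_of_nonneg (by omega)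
  constructor
  · have h : ((((1 : ℤ) * (3 * kOf p) * (1 + 3 * kOf p)).natAbs : ℕ) : ℤ) =
        ((3 * (kOf p).natAbs * (4 * p ^ 2) : ℕ) : ℤ) := by
      push_cast
      rw [hK, abs_of_nonneg (by positivity)]
      linear_combination (3 * kOf p) * h3
    exact_mod_cast h
  · have h : ((3 * (kOf p).natAbs + 1 : ℕ) : ℤ) = ((4 * p ^ 2 : ℕ) : ℤ) := by
      push_cast
      rw [hK]
      linear_combination h3
    exact_mod_cast h

/-- `rad (AB(A+B)) ≤ 8 p³` (indeed `rad ∣ 6 K p`, `3K = 4p² − 1`). -/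
theorem radical_freyFamily_prod_le (hp : ¬ 3 ∣ p) (hp1 : 1 ≤ p) :
    radical ((1 : ℤ) * (3 * kOf p) * (1 + 3 * kOf p)).natAbs ≤ 8 * p ^ 3 := by
  obtain ⟨hn, hK⟩ := natAbs_freyFamily_prod hp hp1
  set K := (kOf p).natAbs with hKdef
  have hK1 : 1 ≤ K := by
    have := one_le_kOf hp hp1
    omega
  have hm0 : 6 * K * p ≠ 0 := by positivity
  have hdvd : ((1 : ℤ) * (3 * kOf p) * (1 + 3 * kOf p)).natAbs ∣ (6 * K * p) ^ 2 := by
    rw [hn]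
    exact ⟨3 * K, by ring⟩
  have h1 : radical ((1 : ℤ) * (3 * kOf p) * (1 + 3 * kOf p)).natAbs ∣ 6 * K * p := by
    have := radical_dvd_radical hdvd (pow_ne_zero 2 hm0)
    rw [radical_pow _ two_ne_zero] at this
    exact this.trans radical_dvd_self
  have h2 : 6 * K * p ≤ 8 * p ^ 3 := by
    have : 3 * K ≤ 4 * p ^ 2 := by omega
    calc 6 * K * p = 2 * p * (3 * K) := by ring
      _ ≤ 2 * p * (4 * p ^ 2) := by gcongr
      _ = 8 * p ^ 3 := by ring
  exact (Nat.le_of_dvd (Nat.pos_of_ne_zero hm0) h1).trans h2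

end Family

/-! ## §2c Membership of `freyFamily p` in the window slices (`κ < 4`, `σ > 12`) -/

section Membership

variable {p : ℕ}

/-- A prime `≥ 5` is prime to `3`. -/
theorem not_three_dvd_of_prime (hp : p.Prime) (h5 : 5 ≤ p) : ¬ 3 ∣ p := by
  intro h
  have := (Nat.prime_dvd_prime_iff_eq Nat.prime_three hp).mp h
  omega

/-- A prime `≥ 5` is odd. -/
theorem odd_of_prime_of_five_le (hp : p.Prime) (h5 : 5 ≤ p) : Odd p :=
  hp.odd_of_ne_two (by omega)

/-- `freyFamily p ⊗ ℚ` is an elliptic curve. -/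
theorem isElliptic_freyFamily (hp3 : ¬ 3 ∣ p) (hp1 : 1 ≤ p) :
    ((freyFamily p).baseChange ℚ).IsElliptic :=
  isElliptic_of_freyCovariants (freyFamily_prod_ne_zero hp3 hp1) (freyFamily_Δ p)

/-- `freyFamily p` is a global minimal model (B–G 12.5.10, first case: `16 ∤ abc`). -/
theorem isMinimalAt_freyFamily (hp3 : ¬ 3 ∣ p) (hp1 : 1 ≤ p) (hodd : Odd p)
    (v : HeightOneSpectrum ℤ) : ((freyFamily p).baseChange ℚ).IsMinimalAt v :=
  isMinimalAt_of_freyCovariants isCoprime_one_left (freyFamily_prod_ne_zero hp3 hp1)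
    (not_sixteen_dvd_freyFamily_prod hp3 hodd) (freyFamily_c₄ p) (freyFamily_Δ p) v

/-- Conductor upper bound `N ≤ 2¹⁰ rad(4p²(4p²−1)) ≤ 2¹³ p³`. -/
theorem conductorNorm_freyFamily_le (hp3 : ¬ 3 ∣ p) (hp1 : 1 ≤ p) (hodd : Odd p) :
    ((freyFamily p).baseChange ℚ).conductorNorm ℤ ≤ 2 ^ 13 * p ^ 3 := by
  have h := conductorNorm_dvd_of_freyCovariants isCoprime_one_left (freyFamily_prod_ne_zero hp3 hp1)
    (not_sixteen_dvd_freyFamily_prod hp3 hodd) (freyFamily_c₄ p) (freyFamily_Δ p)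
  have hr := radical_freyFamily_prod_le hp3 hp1
  calc ((freyFamily p).baseChange ℚ).conductorNorm ℤ
      ≤ 2 ^ 10 * radical ((1 : ℤ) * (3 * kOf p) * (1 + 3 * kOf p)).natAbs :=
        Nat.le_of_dvd (by positivity) h
    _ ≤ 2 ^ 10 * (8 * p ^ 3) := by gcongr
    _ = 2 ^ 13 * p ^ 3 := by ring

/-- Conductor lower bound: `p ∣ N` (multiplicative reduction at `p ∣ 4p²`). -/
theorem dvd_conductorNorm_freyFamily (hp : p.Prime) (h5 : 5 ≤ p) :
    p ∣ ((freyFamily p).baseChange ℚ).conductorNorm ℤ := by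
  have hp3 := not_three_dvd_of_prime hp h5
  have hodd := odd_of_prime_of_five_le hp h5
  refine dvd_conductorNorm_of_freyCovariants isCoprime_one_left
    (freyFamily_prod_ne_zero hp3 hp.one_le) (not_sixteen_dvd_freyFamily_prod hp3 hodd)
    (freyFamily_c₄ p) (freyFamily_Δ p) hp (by omega) ?_
  rw [three_mul_kOf hp3]
  exact Dvd.intro (4 * (p : ℤ) * (4 * (p : ℤ) ^ 2 - 1)) (by ring)

/-- `c₄ > 0` (in particular `≠ 0`: the CM-`j = 0` exclusion is met). -/
theorem freyFamily_c₄_pos (hp3 : ¬ 3 ∣ p) (hp1 : 1 ≤ p) : 0 < (freyFamily p).c₄ := by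
  rw [freyFamily_c₄]
  have := one_le_kOf hp3 hp1
  nlinarith

/-- `c₆ ≠ 0` (the CM-`j = 1728` exclusion is met). -/
theorem freyFamily_c₆_ne_zero (hp3 : ¬ 3 ∣ p) (hp1 : 1 ≤ p) : (freyFamily p).c₆ ≠ 0 := by
  rw [freyFamily_c₆]
  have hk := one_le_kOf hp3 hp1
  have h1 : (0 : ℤ) < 3 * kOf p - 1 := by omega
  have h2 : (0 : ℤ) < 3 * kOf p + 2 := by omega
  have h3 : (0 : ℤ) < 6 * kOf p + 1 := by omega
  exact mul_ne_zero (by norm_num) (mul_pos (mul_pos h1 h2) h3).ne'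

/-- `13824000 p¹² = (240 p⁴)³ ≤ |c₄|³ ≤ M⁺ ≤ 2²⁴ p¹²`. -/
theorem maxInv_freyFamily_bounds (hp3 : ¬ 3 ∣ p) (h2 : 2 ≤ p) :
    13824000 * (p : ℤ) ^ 12 ≤ max |(freyFamily p).Δ| (|(freyFamily p).c₄| ^ 3) ∧
      max |(freyFamily p).Δ| (|(freyFamily p).c₄| ^ 3) ≤ 2 ^ 24 * (p : ℤ) ^ 12 := by
  have hp2 : (2 : ℤ) ≤ p := by exact_mod_cast h2
  have hsq : (4 : ℤ) ≤ (p : ℤ) ^ 2 := by nlinarith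
  have hc₄ := freyFamily_c₄_eq hp3
  have hΔ := freyFamily_Δ_eq hp3
  have hc₄lo : 240 * (p : ℤ) ^ 4 ≤ (freyFamily p).c₄ := by
    rw [hc₄]; nlinarith [pow_nonneg (show (0:ℤ) ≤ (p:ℤ) ^ 2 by positivity) 2]
  have hc₄hi : (freyFamily p).c₄ ≤ 256 * (p : ℤ) ^ 4 := by
    rw [hc₄]; nlinarith
  have hc₄pos : 0 ≤ (freyFamily p).c₄ := le_trans (by positivity) hc₄lo
  have hΔlo : 0 ≤ (freyFamily p).Δ := by rw [hΔ]; positivity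
  have hΔhi : (freyFamily p).Δ ≤ 2 ^ 12 * (p : ℤ) ^ 8 := by
    rw [hΔ]
    have h1 : (0 : ℤ) ≤ 4 * (p : ℤ) ^ 2 - 1 := by nlinarith
    have h2' : (4 * (p : ℤ) ^ 2 - 1) ^ 2 ≤ (4 * (p : ℤ) ^ 2) ^ 2 := by
      apply pow_le_pow_left₀ h1; linarith
    calc 256 * (p : ℤ) ^ 4 * (4 * (p : ℤ) ^ 2 - 1) ^ 2
        ≤ 256 * (p : ℤ) ^ 4 * (4 * (p : ℤ) ^ 2) ^ 2 := by gcongr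
      _ = 2 ^ 12 * (p : ℤ) ^ 8 := by ring
  rw [abs_of_nonneg hΔlo, abs_of_nonneg hc₄pos]
  constructor
  · refine le_trans ?_ (le_max_right _ _)
    calc 13824000 * (p : ℤ) ^ 12 = (240 * (p : ℤ) ^ 4) ^ 3 := by ring
      _ ≤ (freyFamily p).c₄ ^ 3 := pow_le_pow_left₀ (by positivity) hc₄lo 3
  · refine max_le ?_ ?_
    · calc (freyFamily p).Δ ≤ 2 ^ 12 * (p : ℤ) ^ 8 := hΔhi
        _ ≤ 2 ^ 12 * (p : ℤ) ^ 8 * (p : ℤ) ^ 4 := le_mul_of_one_le_right (by positivity)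
            (one_le_pow₀ (by omega))
        _ ≤ 2 ^ 24 * (p : ℤ) ^ 12 := by
          rw [show (2 : ℤ) ^ 12 * (p : ℤ) ^ 8 * (p : ℤ) ^ 4 = 2 ^ 12 * (p : ℤ) ^ 12 by ring]
          gcongr <;> norm_num
    · calc (freyFamily p).c₄ ^ 3 ≤ (256 * (p : ℤ) ^ 4) ^ 3 := pow_le_pow_left₀ hc₄pos hc₄hi 3
        _ = 2 ^ 24 * (p : ℤ) ^ 12 := by ring

/-- Exponent bookkeeping, lower edge: `(2¹³ p³)^κ ≤ (240 p⁴)³` for `κ < 4`, `p ≥ p₀(κ)`. -/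
theorem lower_window_ineq {κ : ℝ} (hκ : κ < 4) :
    ∃ p₀ : ℕ, ∀ p : ℕ, p₀ ≤ p → ((2 : ℝ) ^ 13 * (p : ℝ) ^ 3) ^ κ ≤ 13824000 * (p : ℝ) ^ 12 := by
  set e : ℝ := 12 - 3 * κ with he
  have he0 : 0 < e := by rw [he]; linarith
  obtain ⟨p₀, hp₀⟩ := exists_nat_ge ((2 : ℝ) ^ (13 * κ / e))
  refine ⟨max p₀ 1, fun p hp ↦ ?_⟩
  have hp1 : (1 : ℝ) ≤ p := by exact_mod_cast le_of_max_le_right hp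
  have hpp : (0 : ℝ) < p := by linarith
  have hp₀' : (2 : ℝ) ^ (13 * κ / e) ≤ p := hp₀.trans (by exact_mod_cast le_of_max_le_left hp)
  have h1 : (2 : ℝ) ^ (13 * κ) ≤ (p : ℝ) ^ e := by
    have := Real.rpow_le_rpow (by positivity) hp₀' he0.le
    rwa [← Real.rpow_mul (by norm_num), div_mul_cancel₀ _ he0.ne'] at this
  have h2 : ((2 : ℝ) ^ 13 * (p : ℝ) ^ 3) ^ κ = (2 : ℝ) ^ (13 * κ) * (p : ℝ) ^ (3 * κ) := by
    rw [Real.mul_rpow (by positivity) (by positivity)]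
    congr 1
    · rw [show ((2 : ℝ) ^ 13 : ℝ) = (2 : ℝ) ^ (13 : ℝ) by norm_num, ← Real.rpow_mul (by norm_num)]
    · rw [show ((p : ℝ) ^ 3 : ℝ) = (p : ℝ) ^ (3 : ℝ) by norm_num, ← Real.rpow_mul hpp.le]
  rw [h2]
  calc (2 : ℝ) ^ (13 * κ) * (p : ℝ) ^ (3 * κ) ≤ (p : ℝ) ^ e * (p : ℝ) ^ (3 * κ) := by gcongr
    _ = (p : ℝ) ^ (12 : ℝ) := by rw [← Real.rpow_add hpp]; congr 1; rw [he]; ring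
    _ = (p : ℝ) ^ 12 := by norm_num
    _ ≤ 13824000 * (p : ℝ) ^ 12 := le_mul_of_one_le_left (by positivity) (by norm_num)

/-- Exponent bookkeeping, upper edge: `2²⁴ p¹² ≤ p^σ` for `σ > 12`, `p ≥ p₁(σ)`. -/
theorem upper_window_ineq {σ : ℝ} (hσ : 12 < σ) :
    ∃ p₁ : ℕ, ∀ p : ℕ, p₁ ≤ p → (2 : ℝ) ^ 24 * (p : ℝ) ^ 12 ≤ (p : ℝ) ^ σ := by
  set e : ℝ := σ - 12 with he
  have he0 : 0 < e := by rw [he]; linarith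
  obtain ⟨p₁, hp₁⟩ := exists_nat_ge ((2 : ℝ) ^ (24 / e))
  refine ⟨max p₁ 1, fun p hp ↦ ?_⟩
  have hp1 : (1 : ℝ) ≤ p := by exact_mod_cast le_of_max_le_right hp
  have hpp : (0 : ℝ) < p := by linarith
  have hp₁' : (2 : ℝ) ^ (24 / e) ≤ p := hp₁.trans (by exact_mod_cast le_of_max_le_left hp)
  have h1 : (2 : ℝ) ^ (24 : ℝ) ≤ (p : ℝ) ^ e := by
    have := Real.rpow_le_rpow (by positivity) hp₁' he0.le
    rwa [← Real.rpow_mul (by norm_num), div_mul_cancel₀ _ he0.ne'] at this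
  calc (2 : ℝ) ^ 24 * (p : ℝ) ^ 12 = (2 : ℝ) ^ (24 : ℝ) * (p : ℝ) ^ (12 : ℝ) := by norm_num
    _ ≤ (p : ℝ) ^ e * (p : ℝ) ^ (12 : ℝ) := by gcongr
    _ = (p : ℝ) ^ σ := by rw [← Real.rpow_add hpp]; congr 1; rw [he]; ring

/-- **The Frey family sits in every window `[κ, σ] ⊇ [4 − 0, 12 + 0]`:** for `0 < κ < 4`,
`σ > 12` there is `p₀` such that for every prime `p ≥ p₀` and every `X ≥ 2¹³ p³` the reduced
minimal model `freyFamily p` satisfies every clause of the crux's set-builder predicate. -/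
theorem freyFamily_mem_windowSet {κ σ : ℝ} (hκ0 : 0 < κ) (hκ : κ < 4) (hσ : 12 < σ) :
    ∃ p₀ : ℕ, 5 ≤ p₀ ∧ ∀ p : ℕ, p.Prime → p₀ ≤ p → ∀ X : ℝ, (2 : ℝ) ^ 13 * (p : ℝ) ^ 3 ≤ X →
      freyFamily p ∈ windowSet κ σ X := by
  obtain ⟨p₀, hp₀⟩ := lower_window_ineq hκ
  obtain ⟨p₁, hp₁⟩ := upper_window_ineq hσ
  refine ⟨max 5 (max p₀ p₁), le_max_left _ _, fun p hp hge X hX ↦ ?_⟩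
  have h5 : 5 ≤ p := le_of_max_le_left hge
  have hge₀ : p₀ ≤ p := le_of_max_le_left (le_of_max_le_right hge)
  have hge₁ : p₁ ≤ p := le_of_max_le_right (le_of_max_le_right hge)
  have hp3 := not_three_dvd_of_prime hp h5
  have hodd := odd_of_prime_of_five_le hp h5
  have hp1 : 1 ≤ p := hp.one_le
  haveI hE := isElliptic_freyFamily hp3 hp1
  have hNle : ((((freyFamily p).baseChange ℚ).conductorNorm ℤ : ℕ) : ℝ) ≤ 2 ^ 13 * (p : ℝ) ^ 3 := by
    exact_mod_cast conductorNorm_freyFamily_le hp3 hp1 hodd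
  have hpN : (p : ℝ) ≤ ((((freyFamily p).baseChange ℚ).conductorNorm ℤ : ℕ) : ℝ) := by
    exact_mod_cast Nat.le_of_dvd (conductorNorm_pos_holds _) (dvd_conductorNorm_freyFamily hp h5)
  obtain ⟨hMlo, hMhi⟩ := maxInv_freyFamily_bounds hp3 (by omega)
  have hMlo' : (13824000 : ℝ) * (p : ℝ) ^ 12 ≤
      ((max |(freyFamily p).Δ| (|(freyFamily p).c₄| ^ 3) : ℤ) : ℝ) := by exact_mod_cast hMlo
  have hMhi' : ((max |(freyFamily p).Δ| (|(freyFamily p).c₄| ^ 3) : ℤ) : ℝ) ≤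
      (2 : ℝ) ^ 24 * (p : ℝ) ^ 12 := by exact_mod_cast hMhi
  refine ⟨hE, isMinimalAt_freyFamily hp3 hp1 hodd, Or.inl rfl, Or.inl rfl, Or.inl rfl,
    (freyFamily_c₄_pos hp3 hp1).ne', freyFamily_c₆_ne_zero hp3 hp1, hNle.trans hX, ?_, ?_⟩
  · calc ((((freyFamily p).baseChange ℚ).conductorNorm ℤ : ℕ) : ℝ) ^ κ
        ≤ ((2 : ℝ) ^ 13 * (p : ℝ) ^ 3) ^ κ := Real.rpow_le_rpow (by positivity) hNle hκ0.le
      _ ≤ 13824000 * (p : ℝ) ^ 12 := hp₀ p hge₀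
      _ ≤ _ := hMlo'
  · calc ((max |(freyFamily p).Δ| (|(freyFamily p).c₄| ^ 3) : ℤ) : ℝ)
        ≤ (2 : ℝ) ^ 24 * (p : ℝ) ^ 12 := hMhi'
      _ ≤ (p : ℝ) ^ σ := hp₁ p hge₁
      _ ≤ ((((freyFamily p).baseChange ℚ).conductorNorm ℤ : ℕ) : ℝ) ^ σ :=
          Real.rpow_le_rpow (by positivity) hpN (by linarith)

end Membership

end Summit.ABC.ABC.Theorems.SomeWindowSaving.Negative
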